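import Mathlib
import HarnessLib
import Literature.Analysis.FluidPDE.Tao2016AveragedNS.LocalCascadeSolutions
import Literature.Analysis.FluidPDE.Tao2016AveragedNS.RenormalisedCascadeWaves
import Literature.Analysis.FluidPDE.Tao2016AveragedNS.SelfSimilarCascadeBlowup
import Literature.Analysis.FluidPDE.Tao2016AveragedNS.ViscousEternalSolutions
import Literature.Analysis.FluidPDE.Tao2016AveragedNS.BoundedEternalSolutions
import Summits.NavierStokesRegularity.NavierStokesRegularity.Theorems.TaoLadderRungTwoBreakEternalRigidityViscBddOneDefs
import Summits.NavierStokesRegularity.NavierStokesRegularity.Theorems.WakeRatchetMinimalViscousBlowupMaximalBlowup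
import Summits.NavierStokesRegularity.NavierStokesRegularity.Theorems.WakeRatchetMinimalBlowupExtraction

/-!
# Crux `TaoLadderRungTwoBreak.EternalRigidityViscBddOne` (stmt-NavierStokesRegularity-20420): the open stub (ω4)
# `stub_eternalLimitViscBdd` HOLDS once the blow-up carries WakeRatchet's critical-element data — a kernel
# bridge from the PROVED extraction ⟨22744⟩ to the registered skeleton's vocabulary

The registered skeleton of K2ᵛ(1) (`85fbfe8e90eea58b`) asks in (ω4) `stub_eternalLimitViscBdd` for the ω-limit
extraction from a TYPE-I viscous blow-up `ViscousUpTo ε₀ ν α X₀ X t⋆ ∧ BlowsUpAt ε₀ X t⋆ ∧ TypeOne ε₀ X t⋆` ALONE.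
Route WakeRatchet PROVED the extraction (`MinimalBlowupExtraction` ⟨22744⟩, `…ClockedFrames.minimalBlowupExtraction`,
7-part kit) from a blow-up carrying, besides the type-I clock, three more data: a per-shell ACTION CEILING
`Λ^n ∫₀^{t⋆} ‖X_n‖ ≤ C`, an a=1 ENERGY CEILING `(1+ε₀)^n ‖X_n(t)‖² ≤ C` and a FIRING FLOOR
`∀ n ≥ 0 ∃ t, (1+ε₀)^n ‖X_n(t)‖² ≥ c > 0`.  This file states that bridge in the skeleton's vocabulary:

* `norm_shellVec_le_two_mul` — `‖X_n(t)‖ ≤ 2B` from componentwise bounds `|X_{i,n}(t)| ≤ B` (`m = 4`);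
* `clock_of_typeOne` — `TypeOne` (componentwise) gives WakeRatchet's vector clock with constant `2C`;
* `eternalLimitViscBdd_of_ceilings` — **(ω4)'s conclusion from `ViscousUpTo` + `TypeOne` + action ceiling +
  energy ceiling + firing floor**, for EVERY `ε₀ ≤ 1` and every table of `InTableClass R` (the negative shells are
  zeroed for all times before the proved extraction is invoked; the motion clause transfers by locality of
  `derivWithin` and of `quadTerm`).

READING (repair census for ⟨20420⟩ along this line): (ω4) as registered = this bridge MINUS the three data; the
productive reshaping is to move «action ceiling ∧ energy ceiling ∧ firing floor» into the blow-up stub — which is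
exactly WakeRatchet's open crux `MinimalViscousBlowup` ⟨22743⟩ (threshold viscosity, type I BY SELECTION).

HONEST LABEL: bookkeeping over a proved theorem of another route; MODEL lattice ODEs of Tao 2016 §4 only; (ω3),
(ω4), ⟨20420⟩, ⟨22743⟩ and every NS statement remain OPEN; nothing here bears on the summit.
-/

noncomputable section

-- the summit and its single sub-problem share the name (CONVENTIONS §1)
set_option linter.dupNamespace false

namespace Summit.NavierStokesRegularity.NavierStokesRegularity.Theorems.EternalRigidityViscBddOne.Birth

open Set Filter Topology MeasureTheory
open Literature.Analysis.FluidPDE Literature.Analysis.FluidPDE.TaoCascade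

/-- On four modes, componentwise bounds `|X_{j,n}(t)| ≤ B` give `‖X_n(t)‖ ≤ 2B` for the Euclidean shell vector.
[cite: Tao2016AveragedNS, §4 Lemma 4.1 (the amplitudes `X_{i,n}`); folklore] -/
theorem norm_shellVec_le_two_mul {X : Fin 4 → ℤ → ℝ → ℝ} {n : ℤ} {t B : ℝ} (hB : 0 ≤ B)
    (h : ∀ j : Fin 4, |X j n t| ≤ B) : ‖shellVec X n t‖ ≤ 2 * B := by
  rw [EuclideanSpace.norm_eq]
  have hsum : ∑ j : Fin 4, ‖shellVec X n t j‖ ^ 2 ≤ (2 * B) ^ 2 := by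
    calc ∑ j : Fin 4, ‖shellVec X n t j‖ ^ 2 ≤ ∑ _j : Fin 4, B ^ 2 :=
          Finset.sum_le_sum fun j _ => by
            rw [shellVec_apply, Real.norm_eq_abs]
            exact pow_le_pow_left₀ (abs_nonneg _) (h j) 2
      _ = (2 * B) ^ 2 := by simp; ring
  calc √(∑ j : Fin 4, ‖shellVec X n t j‖ ^ 2) ≤ √((2 * B) ^ 2) := Real.sqrt_le_sqrt hsum
    _ = 2 * B := Real.sqrt_sq (by linarith)

/-- **`TypeOne` gives WakeRatchet's vector type-I clock** `Λ^n (t⋆ − t) ‖X_n(t)‖ ≤ 2C` on `[0, t⋆)`.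
[cite: Tao2016AveragedNS, §4 (4.1), §6.4 (the self-similar rate); cell vocabulary] -/
theorem clock_of_typeOne {ε₀ : ℝ} (hε₀ : 0 < ε₀) {X : Fin 4 → ℤ → ℝ → ℝ} {tStar : ℝ}
    (h : TypeOne ε₀ X tStar) :
    ∃ C : ℝ, ∀ (n : ℤ) (t : ℝ), 0 ≤ t → t < tStar →
      bigLam ε₀ ^ n * (tStar - t) * ‖shellVec X n t‖ ≤ C := by
  obtain ⟨C, hC⟩ := h
  refine ⟨2 * C, fun n t ht0 htT => ?_⟩
  have hΛ : 0 < bigLam ε₀ ^ n := zpow_pos (bigLam_pos (by linarith)) n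
  have hgap : 0 < tStar - t := sub_pos.2 htT
  have hq : 0 < bigLam ε₀ ^ n * (tStar - t) := mul_pos hΛ hgap
  -- componentwise: |X j n t| ≤ C / (Λ^n (t⋆ - t))
  have hcomp : ∀ j : Fin 4, |X j n t| ≤ C / (bigLam ε₀ ^ n * (tStar - t)) := by
    intro j
    rw [le_div_iff₀ hq]
    have := hC t ht0 htT j n
    calc |X j n t| * (bigLam ε₀ ^ n * (tStar - t)) = bigLam ε₀ ^ n * |X j n t| * (tStar - t) := by ring
      _ ≤ C := this
  have hC0 : 0 ≤ C / (bigLam ε₀ ^ n * (tStar - t)) := (abs_nonneg _).trans (hcomp 0)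
  have hnorm := norm_shellVec_le_two_mul hC0 hcomp
  calc bigLam ε₀ ^ n * (tStar - t) * ‖shellVec X n t‖
      ≤ bigLam ε₀ ^ n * (tStar - t) * (2 * (C / (bigLam ε₀ ^ n * (tStar - t)))) :=
        mul_le_mul_of_nonneg_left hnorm hq.le
    _ = 2 * C := by field_simp

/-- The proved extraction of route WakeRatchet, with its (trivial) threshold made explicit: for EVERY `ε₀ > 0`, a
pinned blow-up (`Pinned`: the critical-element data) of a table of `InTableClass R` has a uniformly bounded,
forward-(S₁)-surviving admissible viscous eternal ω-limit (the 3-line assembly of `…ClockedFrames.minimalBlowupExtraction`,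
whose registered statement hides `ε_R := 1` behind `∃ εs`).
[cite: Tao2016AveragedNS, §4 Lemma 4.1, Thm. 4.2, §6.4; tree: `stubClock_holds`, `stubOmegaLimit_holds`, `stubSurvival_holds`] -/
theorem extraction_of_pinned {R ε₀ ν T C c : ℝ} (hε₀ : 0 < ε₀)
    {α : Fin 4 → Fin 4 → Fin 4 → ℤ × ℤ × ℤ → ℝ} {X₀ : Fin 4 → ℝ} (hα : InTableClass R α)
    {X : Fin 4 → ℤ → ℝ → ℝ}
    (hP : Summit.NavierStokesRegularity.NavierStokesRegularity.Cruxes.MinimalBlowupExtraction.ClockedFrames.Pinned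
      ε₀ α X₀ ν T C c X) :
    ∃ (νh : ℝ) (W : ℤ → ℝ → Em 4), IsEternalVisc ε₀ νh α W ∧ UniformBound W ∧
      EternalSurvivingFwd 1 ε₀ W := by
  obtain ⟨c', κ₁, κ₂, hc', hκ₁, hκ₂, τ, hτ⟩ :=
    Summit.NavierStokesRegularity.NavierStokesRegularity.Cruxes.MinimalBlowupExtraction.ClockedFrames.stubClock_holds
      ε₀ R α X₀ ν T C c X hε₀ hα hP
  obtain ⟨νh, W, φ, hφ, hW, hUB, hconv⟩ :=
    Summit.NavierStokesRegularity.NavierStokesRegularity.Cruxes.MinimalBlowupExtraction.ClockedFrames.stubOmegaLimit_holds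
      ε₀ R α X₀ ν T C c X hε₀ hα hP c' κ₁ κ₂ τ hκ₁ hτ
  exact ⟨νh, W, hW, hUB,
    Summit.NavierStokesRegularity.NavierStokesRegularity.Cruxes.MinimalBlowupExtraction.ClockedFrames.stubSurvival_holds
      ε₀ T c' κ₁ κ₂ X τ φ W hε₀ hP.2.1 hc' hκ₁ hκ₂ hτ hφ hconv⟩

/-- **(ω4) from the critical-element data, at EVERY scale ratio.**  For every `ε₀ > 0`, every table of
`InTableClass R`, every viscosity `ν > 0` and every regular solution of the exact `ν`-viscous lattice on `[0, t⋆)`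
(`ViscousUpTo ε₀ ν α X₀ X t⋆`) that is TYPE I (`TypeOne ε₀ X t⋆`) AND carries a per-shell action ceiling, an a=1
energy ceiling and a firing floor on the shells `n ≥ 0`, there is an admissible eternal solution of the renormalised
lattice with some covariant viscosity `ν̂ ≥ 0` that is UNIFORMLY BOUNDED and forward (S₁)-surviving — the conclusion
of the registered stub `stub_eternalLimitViscBdd`.  Proof: zero the negative shells for all times (the motion clause
transfers by locality of `derivWithin` within `[0,∞)` and of `quadTerm` in time) and invoke `extraction_of_pinned`.
[cite: Tao2016AveragedNS, §4 Lemma 4.1 (4.5)–(4.11), Thm. 4.2, §6.4; tree: `…ClockedFrames.minimalBlowupExtraction` ⟨22744⟩] -/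
theorem eternalLimitViscBdd_of_ceilings {R ε₀ ν : ℝ} (hε₀ : 0 < ε₀) (hν : 0 < ν)
    {α : Fin 4 → Fin 4 → Fin 4 → ℤ × ℤ × ℤ → ℝ} {X₀ : Fin 4 → ℝ} (hα : InTableClass R α)
    {X : Fin 4 → ℤ → ℝ → ℝ} {tStar : ℝ} (hV : ViscousUpTo ε₀ ν α X₀ X tStar) (hI : TypeOne ε₀ X tStar)
    (hA : ∃ C : ℝ, ∀ n : ℤ, IntegrableOn (fun t => ‖shellVec X n t‖) (Ico 0 tStar) ∧
      bigLam ε₀ ^ n * (∫ t in Ico 0 tStar, ‖shellVec X n t‖) ≤ C)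
    (hE : ∃ C : ℝ, ∀ (n : ℤ) (t : ℝ), 0 ≤ t → t < tStar → (1 + ε₀) ^ n * ‖shellVec X n t‖ ^ 2 ≤ C)
    (hF : ∃ c : ℝ, 0 < c ∧ ∀ n : ℤ, 0 ≤ n → ∃ t : ℝ, 0 ≤ t ∧ t < tStar ∧
      c ≤ (1 + ε₀) ^ n * ‖shellVec X n t‖ ^ 2) :
    ∃ (νh : ℝ) (W : ℤ → ℝ → Em 4), IsEternalVisc ε₀ νh α W ∧ UniformBound W ∧
      EternalSurvivingFwd 1 ε₀ W := by
  obtain ⟨C₁, hC₁⟩ := clock_of_typeOne hε₀ hI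
  obtain ⟨C₂, hC₂⟩ := hA
  obtain ⟨C₃, hC₃⟩ := hE
  obtain ⟨c, hc, hFl⟩ := hF
  have hT : 0 < tStar := hV.pos
  -- the family with the negative shells zeroed at ALL times
  set Z : Fin 4 → ℤ → ℝ → ℝ := fun i n t => if n < 0 then 0 else X i n t with hZ
  have hZX : ∀ (j : Fin 4) (k : ℤ) (t : ℝ), 0 ≤ t → t < tStar → Z j k t = X j k t := by
    intro j k t ht0 htT
    by_cases hk : k < 0
    · simp only [hZ, if_pos hk]; exact (hV.noLow j k t hk ht0 htT).symm
    · simp only [hZ, if_neg hk]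
  have hZneg : ∀ (j : Fin 4) (k : ℤ) (t : ℝ), k < 0 → Z j k t = 0 := fun j k t hk => by
    simp only [hZ, if_pos hk]
  have hZnn : ∀ (j : Fin 4) (k : ℤ), ¬ k < 0 → Z j k = X j k := fun j k hk => by
    funext t; simp only [hZ, if_neg hk]
  have hsv : ∀ (k : ℤ) (t : ℝ), 0 ≤ t → t < tStar → shellVec Z k t = shellVec X k t := by
    intro k t ht0 htT
    ext j
    rw [shellVec_apply, shellVec_apply, hZX j k t ht0 htT]
  -- the unified constant
  set C : ℝ := max C₁ (max C₂ C₃) with hCdef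
  have h1C : C₁ ≤ C := le_max_left _ _
  have h2C : C₂ ≤ C := (le_max_left _ _).trans (le_max_right _ _)
  have h3C : C₃ ≤ C := (le_max_right _ _).trans (le_max_right _ _)
  refine extraction_of_pinned (R := R) (ν := ν) (T := tStar) (C := C) (c := c) (X₀ := X₀) (X := Z) hε₀ hα
    ⟨hν, hT, hc, ?_, ?_, ?_, ?_, ?_, ?_, ?_, ?_⟩
  · -- C¹ on [0, t⋆)
    intro i n
    by_cases hn : n < 0
    · have : Z i n = fun _ => 0 := funext fun t => hZneg i n t hn
      rw [this]; exact contDiffOn_const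
    · rw [hZnn i n hn]; exact hV.contDiffOn i n
  · -- the one-shell datum
    intro i n
    by_cases hn : n < 0
    · rw [hZneg i n 0 hn, if_neg (by omega)]
    · rw [hZnn i n hn]; exact hV.init i n
  · -- no shells below 0, at all times
    exact fun i n t hn => hZneg i n t hn
  · -- the viscous motion on [0, t⋆)
    intro i n t ht0 htT
    have hq : quadTerm ε₀ α Z i n t = quadTerm ε₀ α X i n t :=
      MinimalViscousBlowup.ThresholdRay.quadTerm_congr_at (fun j k => hZX j k t ht0 htT) i n
    by_cases hn : n < 0
    · have hz : Z i n = fun _ => 0 := funext fun s => hZneg i n s hn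
      -- `X i n` vanishes on `[0, t⋆)`, a neighbourhood of `t` within `[0, ∞)`
      have hev : (X i n) =ᶠ[𝓝[Ici 0] t] (fun _ => (0 : ℝ)) := by
        have hmem : Ici 0 ∩ Iio tStar ∈ 𝓝[Ici 0] t := inter_mem_nhdsWithin (Ici 0) (Iio_mem_nhds htT)
        filter_upwards [hmem] with s hs using hV.noLow i n s hn hs.1 hs.2
      have hdX : derivWithin (X i n) (Ici 0) t = derivWithin (fun _ => (0 : ℝ)) (Ici 0) t :=
        hev.derivWithin_eq (hV.noLow i n t hn ht0 htT)
      have hZ0 : Z i n t = 0 := hZneg i n t hn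
      have hX0 : X i n t = 0 := hV.noLow i n t hn ht0 htT
      have hd : derivWithin (Z i n) (Ici 0) t = derivWithin (X i n) (Ici 0) t := by rw [hz, ← hdX]
      rw [hd, hV.motion i n t ht0 htT, hq, hZ0, hX0]
    · rw [hZnn i n hn, hq]
      exact hV.motion i n t ht0 htT
  · -- the type-I clock
    intro n t ht0 htT
    rw [hsv n t ht0 htT]
    exact (hC₁ n t ht0 htT).trans h1C
  · -- the action ceiling
    intro n
    have heq : EqOn (fun t => ‖shellVec Z n t‖) (fun t => ‖shellVec X n t‖) (Ico 0 tStar) :=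
      fun t ht => by simp only [hsv n t ht.1 ht.2]
    refine ⟨(hC₂ n).1.congr_fun heq.symm measurableSet_Ico, ?_⟩
    rw [setIntegral_congr_fun measurableSet_Ico heq]
    exact (hC₂ n).2.trans h2C
  · -- the energy ceiling
    intro n t ht0 htT
    rw [hsv n t ht0 htT]
    exact (hC₃ n t ht0 htT).trans h3C
  · -- the firing floor
    intro n hn
    obtain ⟨t, ht0, htT, hle⟩ := hFl n hn
    exact ⟨t, ht0, htT, by rw [hsv n t ht0 htT]; exact hle⟩

end Summit.NavierStokesRegularity.NavierStokesRegularity.Theorems.EternalRigidityViscBddOne.Birth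

end
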